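import Summits.FinalStateConjecture.FinalStateConjecture.Theses.SwallowTheDatum
import Literature.Geometry.Lorentzian.CauchyDevelopmentComap
import Literature.Geometry.Lorentzian.DataEmbeddingNormalSmooth

/-!
# Route SwallowTheDatum · item `SubdataDevelopmentsEmbed` (stmt-FinalStateConjecture-10053) —
# hypothesis (2) of the skeleton (`hdod`) from the bare causal statement "the sub-datum is a Cauchy
# hypersurface of some open region of the development" (domain of dependence)

`subdataDevelopmentsEmbed_of_skeleton` (`…SubdataDevelopmentsEmbedSkeleton.lean`) consumes
`hdod`: for every vacuum Cauchy development `𝒟` of `D` on `X` and every smooth open embedding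
`Φ : N → X` with injective differentials there are a vacuum Cauchy development `R` of `D.comap Φ`
and a smooth isometric time-orientation preserving open embedding `χ : R → 𝒟` over `Φ`. With the
re-basing construction `VacuumCauchyDevelopment.comapAlongRestrict` /
`CauchyDevelopment.comapAlongRestrict_embeds` (`Literature/…/CauchyDevelopmentComap.lean`) and the
smoothness of the normal of every data embedding (`DataEmbedding.mdifferentiableAt_embed_normal`,
`Literature/…/DataEmbeddingNormalSmooth.lean`, which discharges the displayed hypothesis `hν`),
`hdod` reduces to PURE CAUSALITY THEORY (`hdod_of_cauchyRegion`): there is an open connected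
`V ⊆ M` containing `ι(Φ N)` in which `ι(Φ N)` is a Cauchy hypersurface — the Cauchy development
(domain of dependence) of the open piece `ι(Φ N)` of the Cauchy hypersurface `ι(X)` (Hawking–Ellis
1973, §6.5–6.6, Prop. 6.6.3; O'Neill 1983, Ch. 14, Lemma 14.38 ff.). Pure composition; no
definition, no named fact.
-/

noncomputable section

open Function Set Filter Topology TopologicalSpace Bundle
open scoped Manifold ContDiff Topology

namespace Summit.FinalStateConjecture.FinalStateConjecture.Theorems

namespace SubdataDevelopmentsEmbed

open Literature.Geometry.Lorentzian

/-- **`hdod` from the domain of dependence.** If for every vacuum Cauchy development `𝒟` of data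
on `X` and every smooth open embedding `Φ : N → X` with injective differentials there is an open
connected `V ⊆ M` containing `ι(Φ N)` in which `ι(Φ N)` is a Cauchy hypersurface (of the open
sub-spacetime `(V, g|_V, τ|_V)`; Hawking–Ellis 1973, Prop. 6.6.3: the Cauchy development of a
piece of a Cauchy hypersurface), then the sub-data `D.comap Φ` have a vacuum Cauchy development
embedding into `𝒟` over `Φ` — namely `(V, g|_V, τ|_V, ι ∘ Φ, ν ∘ Φ)`
(`VacuumCauchyDevelopment.comapAlongRestrict`, with `hν` supplied by
`DataEmbedding.mdifferentiableAt_embed_normal`) and the inclusion `V ⊆ M`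
(`CauchyDevelopment.comapAlongRestrict_embeds`). -/
theorem hdod_of_cauchyRegion
    (hc : ∀ (X : Type) [TopologicalSpace X] [ChartedSpace E3 X] [IsManifold (𝓡 3) ∞ X]
      [T2Space X] [SecondCountableTopology X] [ConnectedSpace X] (D : InitialDataSet (𝓡 3) X)
      (𝒟 : VacuumCauchyDevelopment D) (N : Type) [TopologicalSpace N] [ChartedSpace E3 N]
      [IsManifold (𝓡 3) ∞ N] [ConnectedSpace N] (Φ : N → X)
      (hΦ : ContMDiff (𝓡 3) (𝓡 3) (∞ + 1) Φ) (hΦ' : ∀ u, Injective (mfderiv (𝓡 3) (𝓡 3) Φ u)),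
      IsOpenEmbedding Φ →
      ∃ V : Opens 𝒟.carrier, IsConnected (V : Set 𝒟.carrier) ∧ (∀ u, 𝒟.embed (Φ u) ∈ V) ∧
        (𝒟.metric.restrict PseudoRiemannianMetric.contMDiff_restrict_holds V).IsCauchyHypersurface
          (𝒟.timeOrientation.restrict PseudoRiemannianMetric.contMDiff_restrict_holds
            𝒟.timeOrientation.contMDiff_restrict_holds V) (Subtype.val ⁻¹' range (𝒟.embed ∘ Φ)))
    (X : Type) [TopologicalSpace X] [ChartedSpace E3 X] [IsManifold (𝓡 3) ∞ X]
    [T2Space X] [SecondCountableTopology X] [ConnectedSpace X] (D : InitialDataSet (𝓡 3) X)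
    (𝒟 : VacuumCauchyDevelopment D) (N : Type) [TopologicalSpace N] [ChartedSpace E3 N]
    [IsManifold (𝓡 3) ∞ N] [ConnectedSpace N] (Φ : N → X)
    (hΦ : ContMDiff (𝓡 3) (𝓡 3) (∞ + 1) Φ) (hΦ' : ∀ u, Injective (mfderiv (𝓡 3) (𝓡 3) Φ u))
    (hΦo : IsOpenEmbedding Φ) :
    ∃ (R : VacuumCauchyDevelopment (D.comap Φ hΦ hΦ')) (χ : R.carrier → 𝒟.carrier),
      ContMDiff (𝓡 4) (𝓡 4) ∞ χ ∧ IsOpenEmbedding χ ∧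
        R.metric.IsIsometricImmersion 𝒟.metric.toPseudoRiemannianMetric χ ∧
        R.timeOrientation.PreservesTimeOrientation χ 𝒟.timeOrientation ∧
        χ ∘ R.embed = 𝒟.embed ∘ Φ := by
  obtain ⟨V, hV, hι, hC⟩ := hc X D 𝒟 N Φ hΦ hΦ' hΦo
  have hν : ∀ u, MDifferentiableAt (𝓡 3) (𝓡 4).tangent
      (fun x ↦ (TotalSpace.mk' (EuclideanSpace ℝ (Fin 4)) (𝒟.embed x) (𝒟.normal x) :
        TangentBundle (𝓡 4) 𝒟.carrier)) (Φ u) := fun u ↦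
    𝒟.toDataEmbedding.mdifferentiableAt_embed_normal (Φ u)
  -- the Cauchy hypersurface in the form `comapAlongRestrict` wants (same set, other spelling)
  have hC' : (𝒟.metric.restrict PseudoRiemannianMetric.contMDiff_restrict_holds V).IsCauchyHypersurface
      (𝒟.timeOrientation.restrict PseudoRiemannianMetric.contMDiff_restrict_holds
        𝒟.timeOrientation.contMDiff_restrict_holds V)
      (range ((𝒟.toDataEmbedding.comapAlong Φ hΦ hΦ' hΦo hν).embedOpens V hι)) := by
    intro γ s hγ
    obtain ⟨t, ⟨hts, u, hu⟩, huniq⟩ := hC γ s hγ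
    refine ⟨t, ⟨hts, u, Subtype.ext hu⟩, fun t' ht' ↦ huniq t' ⟨ht'.1, ?_⟩⟩
    obtain ⟨u', hu'⟩ := ht'.2
    exact ⟨u', congrArg Subtype.val hu'⟩
  exact ⟨𝒟.comapAlongRestrict Φ hΦ hΦ' hΦo hν V hV hι hC',
    𝒟.toCauchyDevelopment.comapAlongRestrict_embeds Φ hΦ hΦ' hΦo hν V hV hι hC'⟩

end SubdataDevelopmentsEmbed

end Summit.FinalStateConjecture.FinalStateConjecture.Theorems

end
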